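import Literature.Analysis.FluidPDE.ClassicalLerayProjection
import Literature.Analysis.FluidPDE.NewtonGradientPotential
import Literature.Analysis.FluidPDE.NewtonPotentialGradient
import Literature.Analysis.FluidPDE.NSBoundedMildOseenDuhamel
import Literature.Analysis.UnboundedOperators.HeatKernelBoundedData
import HarnessLib

/-!
# The gradient part of the classical Leray–Helmholtz decomposition: bounds, decay, and its
# pairing with caloric extensions of solenoidal tests

Analysis/FluidPDE support file (theorems only) for `ClassicalLerayProjection.lean`
(`divPotential G = π[G] = Γ ⋆ div G`, `classicalLerayProj G = G - ∇π[G]`), written for the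
Oseen representation of localised classical solutions in the proof of the named fact
`Literature.Analysis.FluidPDE.bradshawGrujicKukavica2015_local_analyticity_radius`. For a test
field `G ∈ C_c^∞(ℝ³; ℝ³)`:

* `fderiv_divPotential_apply` — `∂_a π[G] = T_a(div G)`, the gradient potential
  `T_a g (y) = ∫ ∂_aΓ(y - x) g(x) dx` of `NewtonGradientPotential.lean` (derivatives fall on the
  source and are moved back onto the kernel, Gilbarg–Trudinger Lemma 4.1);
* `exists_forall_abs_divPotential_le`, `exists_forall_norm_gradient_divPotential_le` —
  `π[G]` and `∇π[G]` are bounded (the tree's sup bounds for Newtonian potentials of test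
  sources);
* `norm_newtonGradPotential_le_of_dist`, `norm_gradient_divPotential_le_of_dist` — **off-support
  decay** `‖∇π[G](y)‖ ≤ (4πD²)⁻¹ ‖div G‖_{L¹}` when `supp G ⊆ B̄(c, ρ)` and `dist(y, c) ≥ ρ + D`
  (`‖∇Γ(z)‖ ≤ (4π|z|²)⁻¹`);
* `heatExtension_gradient_divPotential` — `e^{σΔ}(∇π[G]) = ∇(e^{σΔ}π[G])` (derivatives fall on
  bounded `C¹` data, `HeatKernelBoundedData`);
* `integral_inner_gradient_divPotential_heatFlow_eq_zero` — **the gradient part is invisible to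
  caloric extensions of solenoidal tests**: `∫ ⟪∇π[G], e^{σΔ}φ⟫ = 0` for every smooth compactly
  supported divergence-free `φ` and every `σ` (symmetry of the heat semigroup, the previous item,
  and `∫ ⟪∇q, φ⟫ = -∫ q div φ = 0`), whence
  `integral_inner_classicalLerayProj_heatFlow : ∫ ⟪P[G], e^{σΔ}φ⟫ = ∫ ⟪G, e^{σΔ}φ⟫` — the
  self-adjointness of the Leray projection against solenoidal caloric tests, in the classical
  vocabulary (Lemarié-Rieusset 2016, Thm. 6.1 / (6.11): the pressure gradient drops out of the
  Oseen (very weak) formulation).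

## Mathlib / tree search

Tree: `divPotential_apply`, `contDiff_divPotential` (`ClassicalLerayProjection`);
`fderiv_integral_newtonKernel_mul_apply`, `abs_integral_newtonKernel_mul_le`,
`norm_fderiv_integral_newtonKernel_mul_le` (`NewtonPotentialGradient`);
`integral_newtonKernel_smul_fderiv_eq`, `norm_fderiv_newtonKernel_le` (`BiotSavartNewtonKernel`);
`newtonGradPotential` (`NewtonGradientPotential`); `heatFlow`, `heatFlow_of_pos/of_nonpos`
(`MildSolution`); `fderiv_heatExtension_apply_of_bounded`, `heatExtension_clm_comp_of_bound`,
`contDiff_heatExtension_of_bound` (`UnboundedOperators/HeatKernelBoundedData`);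
`integral_inner_heatExtension_comm_of_bound` (`NSBoundedMildOseenDuhamel`);
`integral_inner_gradient_eq_neg_integral_mul_divergence` (`WholeSpaceIBP`);
`isDivFree_heatFlow`, `contDiff_heatFlow` (`MildSolutionProofs`).

## References

* P. G. Lemarié-Rieusset, *The Navier–Stokes Problem in the 21st Century*, CRC Press 2016,
  Thm. 6.1, (6.11)–(6.12) (Oseen / very weak formulation: gradients are invisible to solenoidal
  caloric tests). [LemarieRieusset2016]
* D. Gilbarg, N. S. Trudinger, *Elliptic PDE of Second Order* (2001), Lemma 4.1, (4.9).
  [GilbargTrudinger2001]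
* A. J. Majda, A. L. Bertozzi, *Vorticity and Incompressible Flow*, CUP 2002, §1.8 Prop. 1.16.
  [MajdaBertozziCUP2002]
-/

noncomputable section

open MeasureTheory Set Function Filter Metric Real
open _root_.Topology
open scoped ENNReal ContDiff Laplacian InnerProductSpace RealInnerProductSpace

namespace Literature.Analysis.FluidPDE

variable {G : EuclideanSpace ℝ (Fin 3) → EuclideanSpace ℝ (Fin 3)}

/-! ### The potential as a kernel integral and its derivatives -/

/-- `π[G] = (y ↦ ∫ Γ(y - x) div G(x) dx)` as functions. [folklore] -/
theorem divPotential_eq_integral (G : EuclideanSpace ℝ (Fin 3) → EuclideanSpace ℝ (Fin 3)) :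
    divPotential G = fun y => ∫ x, newtonKernel (y - x) * VectorCalculus.divergence G x :=
  funext (divPotential_apply G)

/-- The divergence of a compactly supported field has compact support (a private copy of
`CalderonSplittingLp.hasCompactSupport_divergence`, not imported here). [folklore] -/
private theorem hasCompactSupport_divergence_of_test (hGc : HasCompactSupport G) :
    HasCompactSupport (VectorCalculus.divergence G) :=
  hGc.mono' fun x hx => by
    by_contra h
    exact hx (divergence_eq_zero_of_notMem_tsupport h)

/-- **`∂_a π[G] = T_a(div G)`**: the derivatives of the potential are the gradient potentials of
the divergence. [cite: GilbargTrudinger2001, Lemma 4.1] -/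
theorem fderiv_divPotential_apply (hG : ContDiff ℝ ∞ G) (hGc : HasCompactSupport G)
    (y a : EuclideanSpace ℝ (Fin 3)) :
    fderiv ℝ (divPotential G) y a = newtonGradPotential a (VectorCalculus.divergence G) y := by
  have hg : ContDiff ℝ ∞ (VectorCalculus.divergence G) := contDiff_divergence_of_contDiff_top hG
  have hgc := hasCompactSupport_divergence_of_test hGc
  rw [divPotential_eq_integral, fderiv_integral_newtonKernel_mul_apply hg hgc y a,
    newtonGradPotential]
  have h2 := integral_newtonKernel_smul_fderiv_eq (F := ℝ) (hg.of_le (by norm_cast)) hgc y a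
  simp only [smul_eq_mul] at h2 ⊢
  exact h2

/-! ### Sup bounds -/

/-- **`π[G]` is bounded.** [cite: GilbargTrudinger2001, Lemma 4.1] -/
theorem exists_forall_abs_divPotential_le (hG : ContDiff ℝ ∞ G) (hGc : HasCompactSupport G) :
    ∃ C : ℝ, ∀ y, |divPotential G y| ≤ C := by
  have hg : Continuous (VectorCalculus.divergence G) := (contDiff_divergence_of_contDiff_top hG).continuous
  have hgc := hasCompactSupport_divergence_of_test hGc
  obtain ⟨B, hB⟩ := hg.bounded_above_of_compact_support hgc
  refine ⟨B + (4 * Real.pi)⁻¹ * ∫ x, |VectorCalculus.divergence G x|, fun y => ?_⟩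
  rw [divPotential_apply]
  exact abs_integral_newtonKernel_mul_le hg hgc (fun x => (Real.norm_eq_abs _).symm.le.trans (hB x)) y

/-- **`∇π[G]` is bounded.** [cite: GilbargTrudinger2001, Lemma 4.1] -/
theorem exists_forall_norm_gradient_divPotential_le (hG : ContDiff ℝ ∞ G)
    (hGc : HasCompactSupport G) : ∃ C : ℝ, ∀ y, ‖gradient (divPotential G) y‖ ≤ C := by
  have hg : ContDiff ℝ ∞ (VectorCalculus.divergence G) := contDiff_divergence_of_contDiff_top hG
  have hgc := hasCompactSupport_divergence_of_test hGc
  have hg1 : ContDiff ℝ 1 (VectorCalculus.divergence G) := hg.of_le (by norm_cast)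
  obtain ⟨B₁, hB₁⟩ := (hg1.continuous_fderiv one_ne_zero).bounded_above_of_compact_support
    (hgc.fderiv ℝ)
  refine ⟨B₁ + (4 * Real.pi)⁻¹ * ∫ x, ‖fderiv ℝ (VectorCalculus.divergence G) x‖, fun y => ?_⟩
  have h := norm_fderiv_integral_newtonKernel_mul_le hg hgc hB₁ y
  rw [← divPotential_eq_integral] at h
  simpa [gradient] using h

/-! ### Off-support decay of the gradient -/

/-- **Off-support bound of a gradient potential**: if `g` is supported in `B̄(c, ρ)` and
`dist(y, c) ≥ ρ + D` with `D > 0`, then `‖T_a g (y)‖ ≤ (4πD²)⁻¹ ‖a‖ ‖g‖_{L¹}`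
(`‖∂_aΓ(y - x)‖ ≤ ‖a‖/(4π‖y - x‖²) ≤ ‖a‖/(4πD²)` on the support). [folklore] -/
theorem norm_newtonGradPotential_le_of_dist {g : EuclideanSpace ℝ (Fin 3) → ℝ}
    (hg : Continuous g) (hgc : HasCompactSupport g)
    {c : EuclideanSpace ℝ (Fin 3)} {ρ D : ℝ} (hD : 0 < D) (hsupp : tsupport g ⊆ closedBall c ρ)
    {y : EuclideanSpace ℝ (Fin 3)} (hy : ρ + D ≤ dist y c) (a : EuclideanSpace ℝ (Fin 3)) :
    ‖newtonGradPotential a g y‖ ≤ (4 * Real.pi * D ^ 2)⁻¹ * ‖a‖ * ∫ x, |g x| := by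
  rw [newtonGradPotential, ← integral_const_mul]
  refine (norm_integral_le_integral_norm _).trans (integral_mono_of_nonneg
    (Eventually.of_forall fun x => norm_nonneg _)
    ((hg.integrable_of_hasCompactSupport hgc).abs.const_mul _) (Eventually.of_forall fun x => ?_))
  show ‖fderiv ℝ newtonKernel (y - x) a • g x‖ ≤ (4 * Real.pi * D ^ 2)⁻¹ * ‖a‖ * |g x|
  by_cases hx : x ∈ tsupport g
  · have hdx : D ≤ ‖y - x‖ := by
      have h1 : dist x c ≤ ρ := mem_closedBall.1 (hsupp hx)
      have h2 : dist y c ≤ dist y x + dist x c := dist_triangle _ _ _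
      rw [← dist_eq_norm]
      linarith
    have hK : ‖fderiv ℝ newtonKernel (y - x) a‖ ≤ (4 * Real.pi * D ^ 2)⁻¹ * ‖a‖ := by
      refine (ContinuousLinearMap.le_opNorm _ _).trans
        (mul_le_mul_of_nonneg_right ?_ (norm_nonneg _))
      refine (norm_fderiv_newtonKernel_le (y - x)).trans (inv_anti₀ (by positivity) ?_)
      exact mul_le_mul_of_nonneg_left (pow_le_pow_left₀ hD.le hdx 2) (by positivity)
    rw [norm_smul, Real.norm_eq_abs]
    exact mul_le_mul_of_nonneg_right hK (abs_nonneg _)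
  · rw [image_eq_zero_of_notMem_tsupport hx, smul_zero, norm_zero, abs_zero, mul_zero]

/-- **Off-support decay of `∇π[G]`**: if `supp G ⊆ B̄(c, ρ)` and `dist(y, c) ≥ ρ + D`, `D > 0`,
then `‖∇π[G](y)‖ ≤ 3 (4πD²)⁻¹ ‖div G‖_{L¹}` (each of the three frame components is a gradient
potential of `div G`). [folklore] -/
theorem norm_gradient_divPotential_le_of_dist (hG : ContDiff ℝ ∞ G) (hGc : HasCompactSupport G)
    {c : EuclideanSpace ℝ (Fin 3)} {ρ D : ℝ} (hD : 0 < D) (hsupp : tsupport G ⊆ closedBall c ρ)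
    {y : EuclideanSpace ℝ (Fin 3)} (hy : ρ + D ≤ dist y c) :
    ‖gradient (divPotential G) y‖ ≤
      3 * ((4 * Real.pi * D ^ 2)⁻¹ * ∫ x, |VectorCalculus.divergence G x|) := by
  have hg : Continuous (VectorCalculus.divergence G) := (contDiff_divergence_of_contDiff_top hG).continuous
  have hgc := hasCompactSupport_divergence_of_test hGc
  have hgsupp : tsupport (VectorCalculus.divergence G) ⊆ closedBall c ρ :=
    closure_minimal (fun x hx => by
      by_contra h
      exact hx (divergence_eq_zero_of_notMem_tsupport fun h' => h (hsupp h'))) isClosed_closedBall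
  set b := EuclideanSpace.basisFun (Fin 3) ℝ with hb
  have hexp : gradient (divPotential G) y = ∑ j, ⟪b j, gradient (divPotential G) y⟫ • b j :=
    (b.sum_repr' _).symm
  have hcomp : ∀ j, ⟪b j, gradient (divPotential G) y⟫ =
      newtonGradPotential (b j) (VectorCalculus.divergence G) y := fun j => by
    rw [real_inner_comm, gradient, InnerProductSpace.toDual_symm_apply,
      fderiv_divPotential_apply hG hGc]
  have hbj : ∀ j, ‖b j‖ = 1 := fun j => b.orthonormal.1 j
  calc ‖gradient (divPotential G) y‖
      = ‖∑ j, ⟪b j, gradient (divPotential G) y⟫ • b j‖ := by rw [← hexp]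
    _ ≤ ∑ j, ‖⟪b j, gradient (divPotential G) y⟫ • b j‖ := norm_sum_le _ _
    _ ≤ ∑ _j : Fin 3, (4 * Real.pi * D ^ 2)⁻¹ * ∫ x, |VectorCalculus.divergence G x| := by
        refine Finset.sum_le_sum fun j _ => ?_
        rw [norm_smul, hbj j, mul_one, hcomp j]
        simpa [hbj j] using norm_newtonGradPotential_le_of_dist hg hgc hD hgsupp hy (b j)
    _ = 3 * ((4 * Real.pi * D ^ 2)⁻¹ * ∫ x, |VectorCalculus.divergence G x|) := by
        simp [Finset.sum_const]

/-! ### The heat flow of the gradient part -/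

/-- `‖∇q(z)‖ = ‖Dq(z)‖` (the Riesz isomorphism is isometric; a private copy of the tree's
`norm_gradient_eq_norm_fderiv` of `NSSereginDecaySliceTerms.lean`, not imported here). [folklore] -/
private theorem norm_gradient_divPotential_eq_norm_fderiv (q : EuclideanSpace ℝ (Fin 3) → ℝ)
    (z : EuclideanSpace ℝ (Fin 3)) : ‖gradient q z‖ = ‖fderiv ℝ q z‖ := by
  rw [gradient, LinearIsometryEquiv.norm_map]

/-- **`e^{σΔ}(∇π[G]) = ∇(e^{σΔ}π[G])`** for `σ > 0`: derivatives fall on the bounded `C¹` data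
`π[G]` (`fderiv_heatExtension_apply_of_bounded`), componentwise through the pairings `⟪a, ·⟫`
(`heatExtension_clm_comp_of_bound`). [folklore] -/
theorem heatExtension_gradient_divPotential (hG : ContDiff ℝ ∞ G) (hGc : HasCompactSupport G)
    {σ : ℝ} (hσ : 0 < σ) (x : EuclideanSpace ℝ (Fin 3)) :
    UnboundedOperators.heatExtension (gradient (divPotential G)) σ x =
      gradient (UnboundedOperators.heatExtension (divPotential G) σ) x := by
  obtain ⟨C₀, hC₀⟩ := exists_forall_abs_divPotential_le hG hGc
  obtain ⟨C₁, hC₁⟩ := exists_forall_norm_gradient_divPotential_le hG hGc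
  have hπ : ContDiff ℝ ∞ (divPotential G) := contDiff_divPotential hG hGc
  have hπ1 : ContDiff ℝ 1 (divPotential G) := hπ.of_le (by norm_cast)
  have hgradc : Continuous (gradient (divPotential G)) := continuous_gradient_of_contDiff hπ1
  have h0 : ∀ z, ‖divPotential G z‖ ≤ C₀ := fun z => by rw [Real.norm_eq_abs]; exact hC₀ z
  refine ext_inner_left ℝ fun a => ?_
  have h1 : ∀ z, ‖fderiv ℝ (divPotential G) z a‖ ≤ C₁ * ‖a‖ := fun z =>
    (ContinuousLinearMap.le_opNorm _ _).trans
      (mul_le_mul_of_nonneg_right (by rw [← norm_gradient_divPotential_eq_norm_fderiv]; exact hC₁ z)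
        (norm_nonneg _))
  have hL := UnboundedOperators.heatExtension_clm_comp_of_bound (innerSL ℝ a) hgradc hC₁ hσ x
  simp only [innerSL_apply_apply] at hL
  -- `⟪a, ∇π z⟫ = Dπ(z) a`
  have hg : ∀ z, ⟪a, gradient (divPotential G) z⟫ = fderiv ℝ (divPotential G) z a := fun z => by
    rw [real_inner_comm, gradient, InnerProductSpace.toDual_symm_apply]
  simp_rw [hg] at hL
  rw [← hL, ← UnboundedOperators.fderiv_heatExtension_apply_of_bounded hπ1 h0 h1 hσ x,
    real_inner_comm, gradient, InnerProductSpace.toDual_symm_apply]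

/-! ### The gradient part against caloric extensions of solenoidal tests -/

/-- **`∫ ⟪∇π[G], e^{σΔ}φ⟫ = 0`** for every smooth compactly supported divergence-free `φ` and
every `σ` (for `σ ≤ 0` the flow is `φ` itself and `∫ ⟪∇q, φ⟫ = -∫ q div φ = 0`; for `σ > 0`
the symmetry `∫ ⟪∇π, e^{σΔ}φ⟫ = ∫ ⟪e^{σΔ}∇π, φ⟫ = ∫ ⟪∇(e^{σΔ}π), φ⟫` reduces to the same).
[cite: LemarieRieusset2016, Thm. 6.1 ((6.11)–(6.12): gradients are invisible to solenoidal caloric tests)] -/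
theorem integral_inner_gradient_divPotential_heatFlow_eq_zero (hG : ContDiff ℝ ∞ G)
    (hGc : HasCompactSupport G) {φ : EuclideanSpace ℝ (Fin 3) → EuclideanSpace ℝ (Fin 3)}
    (hφ : FunctionSpaces.IsTestFunctionOn (⊤ : TopologicalSpace.Opens (EuclideanSpace ℝ (Fin 3))) φ)
    (hdiv : VectorCalculus.IsDivFree φ) (σ : ℝ) :
    ∫ x, ⟪gradient (divPotential G) x, heatFlow φ σ x⟫ = 0 := by
  obtain ⟨C₀, hC₀⟩ := exists_forall_abs_divPotential_le hG hGc
  obtain ⟨C₁, hC₁⟩ := exists_forall_norm_gradient_divPotential_le hG hGc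
  have hπ : ContDiff ℝ ∞ (divPotential G) := contDiff_divPotential hG hGc
  have hπ1 : ContDiff ℝ 1 (divPotential G) := hπ.of_le (by norm_cast)
  have hgradc : Continuous (gradient (divPotential G)) := continuous_gradient_of_contDiff hπ1
  have h0 : ∀ z, ‖divPotential G z‖ ≤ C₀ := fun z => by rw [Real.norm_eq_abs]; exact hC₀ z
  have hφ1 : ContDiff ℝ 1 φ := hφ.contDiff.of_le (by norm_cast)
  have hφc := hφ.hasCompactSupport
  rcases le_or_gt σ 0 with hσ | hσ
  · rw [heatFlow_of_nonpos φ hσ, integral_inner_gradient_eq_neg_integral_mul_divergence hπ1 hφ1 hφc]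
    simp [hdiv _]
  · rw [heatFlow_of_pos φ hσ,
      ← integral_inner_heatExtension_comm_of_bound hgradc.aestronglyMeasurable hC₁
        hφ.contDiff.continuous hφc hσ]
    simp_rw [heatExtension_gradient_divPotential hG hGc hσ]
    have hq1 : ContDiff ℝ 1 (UnboundedOperators.heatExtension (divPotential G) σ) :=
      UnboundedOperators.contDiff_heatExtension_of_bound hπ.continuous h0 hσ
    rw [integral_inner_gradient_eq_neg_integral_mul_divergence hq1 hφ1 hφc]
    simp [hdiv _]

/-- **The classical Leray projection is self-adjoint against solenoidal caloric tests**: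
`∫ ⟪P[G], e^{σΔ}φ⟫ = ∫ ⟪G, e^{σΔ}φ⟫` for `φ` smooth, compactly supported, divergence free.
[cite: MajdaBertozziCUP2002, §1.8 Prop. 1.16 (the projection along gradients)] -/
theorem integral_inner_classicalLerayProj_heatFlow (hG : ContDiff ℝ ∞ G)
    (hGc : HasCompactSupport G) {φ : EuclideanSpace ℝ (Fin 3) → EuclideanSpace ℝ (Fin 3)}
    (hφ : FunctionSpaces.IsTestFunctionOn (⊤ : TopologicalSpace.Opens (EuclideanSpace ℝ (Fin 3))) φ)
    (hdiv : VectorCalculus.IsDivFree φ) (σ : ℝ) :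
    ∫ x, ⟪classicalLerayProj G x, heatFlow φ σ x⟫ = ∫ x, ⟪G x, heatFlow φ σ x⟫ := by
  obtain ⟨C₁, hC₁⟩ := exists_forall_norm_gradient_divPotential_le hG hGc
  have hπ1 : ContDiff ℝ 1 (divPotential G) := (contDiff_divPotential hG hGc).of_le (by norm_cast)
  have hgradc : Continuous (gradient (divPotential G)) := continuous_gradient_of_contDiff hπ1
  have hhf : Integrable (heatFlow φ σ) :=
    integrable_heatFlow (hφ.contDiff.continuous.integrable_of_hasCompactSupport
      hφ.hasCompactSupport) σ
  have hhc : Continuous (heatFlow φ σ) :=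
    (contDiff_heatFlow hφ.contDiff hφ.hasCompactSupport σ).continuous
  have i1 : Integrable (fun x => ⟪G x, heatFlow φ σ x⟫) :=
    integrable_inner_of_hasCompactSupport_left hG.continuous hhc hGc
  have i2 : Integrable (fun x => ⟪gradient (divPotential G) x, heatFlow φ σ x⟫) := by
    refine (hhf.norm.const_mul C₁).mono' (hgradc.inner hhc).aestronglyMeasurable
      (Eventually.of_forall fun x => ?_)
    rw [Real.norm_eq_abs]
    exact (abs_real_inner_le_norm _ _).trans (mul_le_mul_of_nonneg_right (hC₁ x) (norm_nonneg _))
  simp_rw [classicalLerayProj_apply, inner_sub_left]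
  rw [integral_sub i1 i2, integral_inner_gradient_divPotential_heatFlow_eq_zero hG hGc hφ hdiv σ,
    sub_zero]

end Literature.Analysis.FluidPDE
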